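import Summits.QuantumAdvantage.AdviceFreeQNC0.FixedBellsDense
import HarnessLib

/-!
# Cell qa-qnc0 — EXACT LOSERS: the antipodal pair `{0, n}` (planner qa-qnc0-p2 g17 `line17/Sketch17.lean` §3,
statements `ExactLoser`, `antipodalPair`, `AntipodalLoser` VERBATIM)

**`antipodalLoser : AntipodalLoser`**: if `3 ∣ 2c + n` (`n ≥ 1`) the degree-`0` strategy firing exactly the cuts `0` and `n`
LOSES ON EVERY INPUT of the walk game with charge `c`: its two labels `L_0 = c + |u|`, `L_n = c + n + 2|u|` sum to
`2c + n ≡ 0 (mod 3)`, so they are `{0,0}` or `{1,2}` — an even number of charged bells.  (p2: "kills the conjecture that a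
low-degree exact loser has `Γ = 0` a.e."; exact losers form an `𝔽₂`-space.)

WHAT THIS IS NOT: nothing on exact WINNERS (rung (E) `WalkExactHardF`); crux 23029 untouched; separation NOT moved.
-/

noncomputable section

namespace Summit.QuantumAdvantage.AdviceFreeQNC0

open Finset TransferWalk

/-- An exact loser: loses at every input (equivalently `tr Γ ≡ 0`, `Γ ∈ 𝔽₂` pointwise); exact
losers form an `𝔽₂`-space under pointwise XOR of strategies. -/
def ExactLoser {n : ℕ} (c : ℕ) (y : Fin (n + 1) → (Fin n → Bool) → Bool) : Prop :=
  ∀ u : Fin n → Bool, ringWinU c y u = false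

/-- The antipodal pair: fire exactly cuts `0` and `n`, on every input (degree `0`). -/
def antipodalPair (n : ℕ) : Fin (n + 1) → (Fin n → Bool) → Bool :=
  fun g _ => decide (g.val = 0 ∨ g.val = n)

/-- Statement: if `3 ∣ 2c + n` the antipodal pair is an exact loser (its two labels are `{0,0}` or
`{1,2}`), although `Γ = 1 ≠ 0` on the inputs with `c + |u| ≢ 0` (density `2/3`). -/
def AntipodalLoser : Prop :=
  ∀ n c : ℕ, 1 ≤ n → (2 * c + n) % 3 = 0 → ExactLoser c (antipodalPair n)

/-- `L_0 + L_n = (c + |u|) + (c + n + 2|u|) ≡ 2c + n (mod 3)` — the one label SUM a strategy knows for free. -/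
theorem antipodal_label_sum {n : ℕ} (c : ℕ) (u : Fin n → Bool) :
    ((c + 0 + walkExp u 0) + (c + n + walkExp u n)) % 3 = (2 * c + n) % 3 := by
  unfold walkExp
  rw [TransferWalk.wtPrefix_zero, ← wt_eq_wtPrefix]
  omega

/-- **`antipodalLoser : AntipodalLoser` — PROVED.** -/
theorem antipodalLoser : AntipodalLoser := by
  intro n c hn hmod u
  have hsum := antipodal_label_sum c u
  rw [hmod] at hsum
  have hiff : (c + 0 + walkExp u 0) % 3 ≠ 0 ↔ (c + n + walkExp u n) % 3 ≠ 0 := by omega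
  unfold ringWinU antipodalPair
  rw [decide_eq_false_iff_not]
  set g0 : Fin (n + 1) := ⟨0, by omega⟩ with hg0
  set gn : Fin (n + 1) := ⟨n, by omega⟩ with hgn
  have hne : g0 ≠ gn := by
    intro h; have := congrArg Fin.val h; simp [hg0, hgn] at this; omega
  have hset : (univ.filter fun g : Fin (n + 1) =>
      decide (g.val = 0 ∨ g.val = n) = true ∧ (c + g.val + walkExp u g.val) % 3 ≠ 0) =
      ({g0, gn} : Finset (Fin (n + 1))).filter fun g => (c + g.val + walkExp u g.val) % 3 ≠ 0 := by
    ext g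
    simp only [mem_filter, mem_univ, true_and, mem_insert, mem_singleton, decide_eq_true_eq, Fin.ext_iff, hg0, hgn]
  rw [hset, Finset.filter_insert, Finset.filter_singleton]
  by_cases h0 : (c + g0.val + walkExp u g0.val) % 3 ≠ 0
  · have hn' : (c + gn.val + walkExp u gn.val) % 3 ≠ 0 := hiff.1 h0
    rw [if_pos h0, if_pos hn', card_insert_of_notMem (by simpa using hne), card_singleton]
    norm_num
  · have hn' : ¬ (c + gn.val + walkExp u gn.val) % 3 ≠ 0 := fun h => h0 (hiff.2 h)
    rw [if_neg h0, if_neg hn']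
    simp

end Summit.QuantumAdvantage.AdviceFreeQNC0

end
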